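import Summits.BirchSwinnertonDyer.BirchSwinnertonDyer.Theorems.ResidualThetaTransportAtTwoSignedMuSeedAtTwoPlusSmoothingCoboundaryOrbit
import Summits.BirchSwinnertonDyer.BirchSwinnertonDyer.Theorems.ResidualThetaTransportAtTwoSignedMuSeedAtTwoPlusSmoothingCoboundaryBridge
import HarnessLib

/-!
# Smoothing coboundary XI — assembly: CS3 `LevelZeroLaw` and CS5 `ClassSeries` VERBATIM modulo the kernel cocycle CS1
# (orbit re-indexing `…Orbit` + coboundary laws `…SmoothingCoboundary` + the power-series unit `…Bridge`, composed)
# (seed crux `SignedMuSeedAtTwoPlus` stmt-BirchSwinnertonDyer-21438; parent Kμ⁺ stmt-BirchSwinnertonDyer-20689, route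
# ResidualThetaTransportAtTwo; line card `Cruxes/SignedMuSeedAtTwoPlus/Lines/smoothing-coboundary.md`, stubs CS3, CS5)

Cell `bsd-wall`, width seat `bsd-wall-rtt-p4-w2` g15 (`--supports`, closes nothing).  THEOREMS ONLY; BSD is not proved by this.

Input (= the conclusion of CS1 for each orbit point): a family `L a : G → R` (level `0`) or `L a : G → V` (all orders) on a finite
commutative orbit group `G` with `L (a*b) c = L b c + τ b * L a (φ b * c)` (resp. `… + τ b • ρ b (L a (φ b * c))`), `τ` the tangent
character, `φ : M →* G` the action on the orbit, `χ : G →* R` a character.  Output: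

* `orbitMultiplier`-free packaging: the multiplier `η = τ · (χ ∘ inv ∘ φ)` as a monoid hom (`orbitMultiplierHom_apply`);
* **`levelZeroLaw`** (CS3): one `b₀` with `τ b₀·χ(φ b₀)⁻¹ − 1` a unit ⟹ `∃ κ, ∀ a, Σ_c χ c·L a c = κ·(τ a·χ(φ a)⁻¹ − 1)`
  («`f_e(α) = κ_{χ₀^e}·(1 + ω̃(α)χ₀(α)^e)` for every odd `α` prime to `𝔣₀`»; in particular «`E₀(χ; 𝔩) = κ_χ(1 + η(π_𝔩))`»),
  `levelZero_silent_everywhere` (vanishing at that `b₀` ⟹ vanishing at all `a`), `levelZero_eq_zero_iff` (no zero divisors: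
  `Σ_c χ c·L a c = 0 ⟺ κ = 0 ∨ τ a·χ(φ a)⁻¹ = 1`);
* **`classSeriesLaw`** (CS5, abstract operators): one `b₀` with `(τ b₀·χ(φ b₀)⁻¹) • ρ b₀ − 1` a unit ⟹
  `∃ G, ∀ a, Σ_c χ c • L a c = ((τ a·χ(φ a)⁻¹) • ρ a − 1) G` («`F°_α = G_χ + η(α)·G_χ∘[α]`»);
* **`classSeriesLaw_subst`**, `classSeries_unique` (CS5 in the power-series model `V = k⟦T⟧`, `ρ b₀ = (∘ s)`, `s ≡ T (mod T²)`,
  `τ b₀·χ(φ b₀)⁻¹ − 1` a unit of `k`): the class series EXISTS and is UNIQUE — no unit hypothesis left.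

[folklore]
-/

noncomputable section

set_option autoImplicit false
-- the Theorems namespace of this sub repeats the summit name by design (D-0017 nested layout)
set_option linter.dupNamespace false

open Finset PowerSeries

namespace Summit.BirchSwinnertonDyer.BirchSwinnertonDyer.Theorems.SignedMuAtTwo.SmoothingCoboundary

section LevelZero

variable {M R G : Type*} [CommMonoid M] [CommRing R] [CommGroup G] [Fintype G]
  (φ : M →* G) (τ : M →* R) (χ : G →* R)

omit [Fintype G] in
/-- The orbit multiplier `b ↦ τ b·χ(φ b)⁻¹` packaged as the monoid hom `τ * (χ ∘ inv ∘ φ)`. [folklore] -/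
theorem orbitMultiplierHom_apply (b : M) :
    (τ * χ.comp ((invMonoidHom : G →* G).comp φ)) b = τ b * χ (φ b)⁻¹ := by
  rw [MonoidHom.mul_apply, MonoidHom.comp_apply, MonoidHom.comp_apply, invMonoidHom_apply]

/-- **CS3 `LevelZeroLaw`** (modulo CS1): the orbit functionals of a twisted cocycle of functions are ONE coboundary:
`∃ κ, ∀ a, Σ_c χ c·L a c = κ·(τ a·χ(φ a)⁻¹ − 1)`, as soon as one `τ b₀·χ(φ b₀)⁻¹ − 1` is a unit. [folklore] -/
theorem levelZeroLaw (L : M → G → R) (hL : ∀ a b c, L (a * b) c = L b c + τ b * L a (φ b * c))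
    (hb : ∃ b₀, IsUnit (τ b₀ * χ (φ b₀)⁻¹ - 1)) :
    ∃ κ : R, ∀ a, ∑ c, χ c * L a c = κ * (τ a * χ (φ a)⁻¹ - 1) := by
  have hf : ∀ a b, (∑ c, χ c * L (a * b) c)
      = (∑ c, χ c * L b c) + (τ * χ.comp ((invMonoidHom : G →* G).comp φ)) b * ∑ c, χ c * L a c := by
    intro a b
    rw [orbitMultiplierHom_apply]
    exact orbitSum_cocycle φ τ χ L hL a b
  obtain ⟨b₀, hb₀⟩ := hb
  obtain ⟨κ, hκ⟩ := coboundaryLaw (τ * χ.comp ((invMonoidHom : G →* G).comp φ)) (fun a => ∑ c, χ c * L a c) hf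
    ⟨b₀, by rwa [orbitMultiplierHom_apply]⟩
  exact ⟨κ, fun a => by rw [hκ a, orbitMultiplierHom_apply]⟩

/-- **Silent at one good element ⇒ silent everywhere** for orbit functionals (the auxiliary prime carries no information).
[folklore] -/
theorem levelZero_silent_everywhere (L : M → G → R) (hL : ∀ a b c, L (a * b) c = L b c + τ b * L a (φ b * c))
    {b₀ : M} (hb₀ : IsUnit (τ b₀ * χ (φ b₀)⁻¹ - 1)) (h0 : ∑ c, χ c * L b₀ c = 0) (a : M) :
    ∑ c, χ c * L a c = 0 := by
  have hf : ∀ a b, (∑ c, χ c * L (a * b) c)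
      = (∑ c, χ c * L b c) + (τ * χ.comp ((invMonoidHom : G →* G).comp φ)) b * ∑ c, χ c * L a c := by
    intro a b
    rw [orbitMultiplierHom_apply]
    exact orbitSum_cocycle φ τ χ L hL a b
  exact eq_zero_of_apply_eq_zero (τ * χ.comp ((invMonoidHom : G →* G).comp φ)) (fun a => ∑ c, χ c * L a c) hf
    (b₀ := b₀) (by rwa [orbitMultiplierHom_apply]) h0 a

/-- The vanishing criterion for orbit functionals (no zero divisors): with `κ` as in `levelZeroLaw`,
`Σ_c χ c·L a c = 0 ⟺ κ = 0 ∨ τ a·χ(φ a)⁻¹ = 1`. [folklore] -/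
theorem levelZero_eq_zero_iff [NoZeroDivisors R] (L : M → G → R) {κ : R}
    (hκ : ∀ a, ∑ c, χ c * L a c = κ * (τ a * χ (φ a)⁻¹ - 1)) (a : M) :
    ∑ c, χ c * L a c = 0 ↔ κ = 0 ∨ τ a * χ (φ a)⁻¹ = 1 := by
  rw [hκ a, mul_eq_zero, sub_eq_zero]

end LevelZero

section ClassSeries

variable {M R G V : Type*} [CommMonoid M] [CommRing R] [CommGroup G] [Fintype G] [AddCommGroup V] [Module R V]
  (φ : M →* G) (τ : M →* R) (χ : G →* R) (ρ : M →* Module.End R V)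

/-- **CS5 `ClassSeries`** (modulo CS1, abstract operators): `∃ G, ∀ a, Σ_c χ c • L a c = ((τ a·χ(φ a)⁻¹) • ρ a − 1) G` as soon
as one twisting operator `(τ b₀·χ(φ b₀)⁻¹) • ρ b₀ − 1` is a unit. [folklore] -/
theorem classSeriesLaw (L : M → G → V) (hL : ∀ a b c, L (a * b) c = L b c + τ b • ρ b (L a (φ b * c)))
    (hb : ∃ b₀, IsUnit ((τ b₀ * χ (φ b₀)⁻¹) • ρ b₀ - 1 : Module.End R V)) :
    ∃ Gv : V, ∀ a, ∑ c, χ c • L a c = ((τ a * χ (φ a)⁻¹) • ρ a - 1 : Module.End R V) Gv := by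
  have hF : ∀ a b, (∑ c, χ c • L (a * b) c)
      = (∑ c, χ c • L b c) + (τ * χ.comp ((invMonoidHom : G →* G).comp φ)) b • ρ b (∑ c, χ c • L a c) := by
    intro a b
    rw [orbitMultiplierHom_apply]
    exact orbitSum_opCocycle φ τ χ ρ L hL a b
  obtain ⟨b₀, hb₀⟩ := hb
  obtain ⟨Gv, hG⟩ := operatorCoboundaryLaw (τ * χ.comp ((invMonoidHom : G →* G).comp φ)) ρ
    (fun a => ∑ c, χ c • L a c) hF ⟨b₀, by rwa [orbitMultiplierHom_apply]⟩
  exact ⟨Gv, fun a => by rw [hG a, orbitMultiplierHom_apply]⟩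

end ClassSeries

section PowerSeriesModel

variable {M k G : Type*} [CommMonoid M] [CommRing k] [CommGroup G] [Fintype G]
  (φ : M →* G) (τ : M →* k) (χ : G →* k) (ρ : M →* Module.End k (PowerSeries k))

/-- **CS5 in the power-series model, no unit hypothesis left**: if one `ρ b₀` is substitution by `s ≡ T (mod T²)` and
`τ b₀·χ(φ b₀)⁻¹ − 1` is a unit of `k` (card: `β ≡ 1 (mod 2𝒪_K)`, `χ₀(β) ≠ 1`), the class series exists:
`∃ G, ∀ a, Σ_c χ c • L a c = ((τ a·χ(φ a)⁻¹) • ρ a − 1) G`. [folklore] -/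
theorem classSeriesLaw_subst (L : M → G → PowerSeries k)
    (hL : ∀ a b c, L (a * b) c = L b c + τ b • ρ b (L a (φ b * c))) {b₀ : M}
    (hη : IsUnit (τ b₀ * χ (φ b₀)⁻¹ - 1)) {s : PowerSeries k} (hs0 : constantCoeff s = 0) (hs1 : coeff 1 s = 1)
    (hρ : ρ b₀ = (substAlgHom (HasSubst.of_constantCoeff_zero' hs0)).toLinearMap) :
    ∃ Gs : PowerSeries k, ∀ a,
      ∑ c, χ c • L a c = ((τ a * χ (φ a)⁻¹) • ρ a - 1 : Module.End k (PowerSeries k)) Gs := by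
  refine classSeriesLaw φ τ χ ρ L hL ⟨b₀, ?_⟩
  rw [hρ]
  exact isUnit_twistSubstEnd hη hs0 hs1

/-- … and it is UNIQUE (card: `G_χ` canonical). [folklore] -/
theorem classSeries_unique (L : M → G → PowerSeries k) {b₀ : M} (hη : IsUnit (τ b₀ * χ (φ b₀)⁻¹ - 1))
    {s : PowerSeries k} (hs0 : constantCoeff s = 0) (hs1 : coeff 1 s = 1)
    (hρ : ρ b₀ = (substAlgHom (HasSubst.of_constantCoeff_zero' hs0)).toLinearMap) {Gs Gs' : PowerSeries k}
    (hG : ∀ a, ∑ c, χ c • L a c = ((τ a * χ (φ a)⁻¹) • ρ a - 1 : Module.End k (PowerSeries k)) Gs)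
    (hG' : ∀ a, ∑ c, χ c • L a c = ((τ a * χ (φ a)⁻¹) • ρ a - 1 : Module.End k (PowerSeries k)) Gs') :
    Gs = Gs' :=
  classSeries_unique_subst (τ * χ.comp ((invMonoidHom : G →* G).comp φ)) ρ (b₀ := b₀)
    (by rwa [orbitMultiplierHom_apply]) hs0 hs1 hρ
    (by rw [orbitMultiplierHom_apply, ← hG b₀, ← hG' b₀])

end PowerSeriesModel

end Summit.BirchSwinnertonDyer.BirchSwinnertonDyer.Theorems.SignedMuAtTwo.SmoothingCoboundary
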